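import Literature.AlgebraicGeometry.Frobenioids.Cor411iiBiratApex
import HarnessLib

/-!
# Frobenioids I, Corollary 4.11 (ii) AS TYPED over the setting of the proof of Theorem 4.2

Mochizuki, *The geometry of Frobenioids I: the general theory*, Kyushu J. Math. **62** (2008)
293–400, Cor. 4.11 (ii) p. 91, proof pp. 92–94 [cite: MochizukiFrdI2008, Cor. 4.11 (ii) p.91]; the
reductions "we may assume without loss of generality that `C₁, C₂` are of isotropic type … not of group-like
type" (p. 92) and "by passing to perfections" (proof of Thm. 4.2, p. 78; of Thm. 4.9, p. 89).

PROOF-ONLY file (seat abc-iut-L1-d6, cell sub-DAG S2 `plan/L1/SUBDAG-FrdI-Cor411.md`, apex): the typed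
`(ofFunctor Φ₁ F₁).Cor411ii (ofFunctor Φ₂ F₂) Ψ` over `FrdI.T42.Setting F₁ F₂ Ψ` (seat abc-iut-L1-t14: Frobenioids
of perfect and isotropic type, `Φ_i` perf-factorial, and the conclusions of Thm. 3.4 (ii)(iii) for `Ψ`, `Ψ⁻¹`),
given in addition `HasBiratSquares`, the Frobenioid structures of the birationalizations (Prop. 4.4 (ii)),
bases of FSMFF-type Div-slim relative to the non-dilating `Φ_i` (the hypotheses of Cor. 4.11 with
Def. 3.1 (i)(d)(e)), and "`Ψ`, `Ψ⁻¹` preserve primary pre-steps" (Thm. 4.2 (i)) — by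
`PreFrobenioid.cor411ii_inst_of_perfect` (`Cor411iiBiratApex.lean`), the clauses "linear morphisms" and
"base-isomorphisms" being reduced to the fields of the setting (Frobenius degrees; Prop. 1.7 (ii)).
No new definitions; nothing of the paper is restated; nothing here is specific to the abc programme.
-/

namespace Literature.AlgebraicGeometry.Frobenioids

open CategoryTheory Opposite

namespace FrdI.T42

open PreFrobenioid

universe w₀ v₀ v₀' u₀ u₀'

variable {D₁ : Type u₀} [Category.{v₀} D₁] {Φ₁ : D₁ᵒᵖ ⥤ CommMonCat.{w₀}} {C₁ : Type u₀'} [Category.{v₀'} C₁]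
  {D₂ : Type u₀} [Category.{v₀} D₂] {Φ₂ : D₂ᵒᵖ ⥤ CommMonCat.{w₀}} {C₂ : Type u₀'} [Category.{v₀'} C₂]
  {F₁ : C₁ ⥤ ElemFrobenioid Φ₁} {F₂ : C₂ ⥤ ElemFrobenioid Φ₂} {Ψ : C₁ ≌ C₂}

/-- Frobenius degrees are invariant under conjugation by isomorphisms; hence `Ψ⁻¹` preserves them when `Ψ`
does. [cite: MochizukiFrdI2008, Thm. 3.4 (iii) p.62] -/
theorem degFr_inverse_map (S : Setting F₁ F₂ Ψ) ⦃X Y : C₂⦄ (φ : X ⟶ Y) :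
    degFr F₁ (Ψ.inverse.map φ) = degFr F₂ φ := by
  -- the counit, with clean object names
  have hεty : ∀ Z : C₂, ∃ e : Ψ.functor.obj (Ψ.inverse.obj Z) ≅ Z, e = Ψ.counitIso.app Z :=
    fun Z => ⟨_, rfl⟩
  choose ε hε₀ using hεty
  have hε' : Ψ.functor.map (Ψ.inverse.map φ) ≫ (ε Y).hom = (ε X).hom ≫ φ := by
    rw [hε₀ X, hε₀ Y]
    have := Ψ.counitIso.hom.naturality φ
    dsimp at this
    exact this
  have e : Ψ.functor.map (Ψ.inverse.map φ) = (ε X).hom ≫ φ ≫ (ε Y).symm.hom := by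
    rw [Iso.symm_hom, ← Category.assoc, ← hε', Category.assoc, Iso.hom_inv_id, Category.comp_id]
  have h := S.degFr_map (Ψ.inverse.map φ)
  rw [e, PreFrobenioid.degFr_comp, PreFrobenioid.degFr_comp, PreFrobenioid.degFr_iso_hom F₂ (ε X),
    PreFrobenioid.degFr_iso_hom F₂ (ε Y).symm, one_mul, mul_one] at h
  exact h.symm

set_option backward.isDefEq.respectTransparency false in
/-- **The base square of [FrdI] Cor. 4.11 (ii) over `FrdI.T42.Setting`** (the setting of the proof of Thm. 4.2 after
its reductions — Frobenioids of perfect and isotropic type, `Φ_i` perf-factorial, the conclusions of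
Thm. 3.4 (ii)(iii) for `Ψ`, `Ψ⁻¹`; seat abc-iut-L1-t14), given in addition: `HasBiratSquares` and the
Frobenioid structures of the birationalizations (Prop. 4.4 (ii), `hB_i`), bases of FSMFF-type Div-slim
relative to the non-dilating `Φ_i` (the hypotheses of Cor. 4.11 with Def. 3.1 (i)(d)(e)), and "`Ψ`, `Ψ⁻¹`
preserve primary pre-steps" (Thm. 4.2 (i)). Base-isomorphisms = Frobenius type ≫ pre-step (Prop. 1.7 (ii))
and linear = Frobenius degree `1` reduce the remaining clauses to the fields of the setting.
[cite: MochizukiFrdI2008, Cor. 4.11 (ii) p.91] -/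
theorem exists_base_equivalence_inst_of_setting (S : Setting F₁ F₂ Ψ)
    (hsq₁ : HasBiratSquares F₁) (hsq₂ : HasBiratSquares F₂)
    (hB₁ : IsFrobenioid (Birat.toElemZero S.isFrobenioid₁ hsq₁))
    (hB₂ : IsFrobenioid (Birat.toElemZero S.isFrobenioid₂ hsq₂))
    (hD₁ : IsOfFSMFFType D₁) (hD₂ : IsOfFSMFFType D₂)
    (hnd₁ : IsNonDilatingOn Φ₁) (hnd₂ : IsNonDilatingOn Φ₂)
    (hds₁ : (PreFrobenioidData.ofFunctor Φ₁ F₁).IsDivSlim) (hds₂ : (PreFrobenioidData.ofFunctor Φ₂ F₂).IsDivSlim)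
    (hprim : ∀ ⦃X Y : C₁⦄ (φ : X ⟶ Y), IsPrimaryPreStep F₁ φ → IsPrimaryPreStep F₂ (Ψ.functor.map φ))
    (hprim' : ∀ ⦃X Y : C₂⦄ (φ : X ⟶ Y), IsPrimaryPreStep F₂ φ → IsPrimaryPreStep F₁ (Ψ.inverse.map φ)) :
    ∃ ΨBase : D₁ ⥤ D₂, ΨBase.IsEquivalence ∧
      OneCommutes Ψ.functor (PreFrobenioidData.ofFunctor Φ₂ F₂).base (PreFrobenioidData.ofFunctor Φ₁ F₁).base
        ΨBase := by
  have hF₁ := S.isFrobenioid₁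
  have hF₂ := S.isFrobenioid₂
  -- linear morphisms: Frobenius degree `1`
  have hlin : ∀ ⦃X Y : C₁⦄ (φ : X ⟶ Y), IsLinear F₁ φ → IsLinear F₂ (Ψ.functor.map φ) := by
    intro X Y φ hφ
    change degFr F₂ (Ψ.functor.map φ) = 1
    rw [S.degFr_map]
    exact hφ
  have hlin' : ∀ ⦃X Y : C₂⦄ (φ : X ⟶ Y), IsLinear F₂ φ → IsLinear F₁ (Ψ.inverse.map φ) := by
    intro X Y φ hφ
    change degFr F₁ (Ψ.inverse.map φ) = 1
    rw [degFr_inverse_map S]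
    exact hφ
  -- base-isomorphisms: Frobenius type ≫ pre-step (Prop. 1.7 (ii))
  have hbi : ∀ ⦃X Y : C₁⦄ (φ : X ⟶ Y), IsBaseIso F₁ φ → IsBaseIso F₂ (Ψ.functor.map φ) := by
    intro X Y φ hφ
    obtain ⟨Z, b, a, hfac, hb, ha⟩ := (isBaseIso_iff_exists_frobeniusType_preStep F₁ hF₁ φ).mp hφ
    rw [← hfac, Functor.map_comp]
    haveI : IsIso (Base F₂ (Ψ.functor.map b)) := (S.frobeniusType_map b hb).2
    haveI : IsIso (Base F₂ (Ψ.functor.map a)) := (S.preStep_map a ha).2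
    change IsIso (Base F₂ (Ψ.functor.map b ≫ Ψ.functor.map a))
    rw [base_comp]
    infer_instance
  have hbi' : ∀ ⦃X Y : C₂⦄ (φ : X ⟶ Y), IsBaseIso F₂ φ → IsBaseIso F₁ (Ψ.inverse.map φ) := by
    intro X Y φ hφ
    obtain ⟨Z, b, a, hfac, hb, ha⟩ := (isBaseIso_iff_exists_frobeniusType_preStep F₂ hF₂ φ).mp hφ
    rw [← hfac, Functor.map_comp]
    haveI : IsIso (Base F₁ (Ψ.inverse.map b)) := (S.frobeniusType_inv b hb).2
    haveI : IsIso (Base F₁ (Ψ.inverse.map a)) := (S.preStep_inv a ha).2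
    change IsIso (Base F₁ (Ψ.inverse.map b ≫ Ψ.inverse.map a))
    rw [base_comp]
    infer_instance
  exact exists_base_equivalence_inst_of_perfect hF₁ hsq₁ hF₂ hsq₂ Ψ hB₁ hB₂ hD₁ hD₂ S.perfect₁ S.perfect₂
    S.isotropic₁
    S.isotropic₂ S.perfFactorial₁ S.perfFactorial₂ hnd₁ hnd₂ hds₁ hds₂ S.preStep_map S.preStep_inv
    S.frobeniusType_map S.frobeniusType_inv hlin hlin' hbi hbi' S.pullback_map S.pullback_inv hprim hprim'

/-- **[FrdI] Cor. 4.11 (ii) AS TYPED over `FrdI.T42.Setting`** — `exists_base_equivalence_inst_of_setting`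
followed by the `1`-uniqueness and rigidity theorems (`cor411ii_of_exists_base_equivalence'`).
[cite: MochizukiFrdI2008, Cor. 4.11 (ii) p.91] -/
theorem cor411ii_inst_of_setting (S : Setting F₁ F₂ Ψ)
    (hsq₁ : HasBiratSquares F₁) (hsq₂ : HasBiratSquares F₂)
    (hB₁ : IsFrobenioid (Birat.toElemZero S.isFrobenioid₁ hsq₁))
    (hB₂ : IsFrobenioid (Birat.toElemZero S.isFrobenioid₂ hsq₂))
    (hD₁ : IsOfFSMFFType D₁) (hD₂ : IsOfFSMFFType D₂)
    (hnd₁ : IsNonDilatingOn Φ₁) (hnd₂ : IsNonDilatingOn Φ₂)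
    (hds₁ : (PreFrobenioidData.ofFunctor Φ₁ F₁).IsDivSlim) (hds₂ : (PreFrobenioidData.ofFunctor Φ₂ F₂).IsDivSlim)
    (hprim : ∀ ⦃X Y : C₁⦄ (φ : X ⟶ Y), IsPrimaryPreStep F₁ φ → IsPrimaryPreStep F₂ (Ψ.functor.map φ))
    (hprim' : ∀ ⦃X Y : C₂⦄ (φ : X ⟶ Y), IsPrimaryPreStep F₂ φ → IsPrimaryPreStep F₁ (Ψ.inverse.map φ)) :
    (PreFrobenioidData.ofFunctor Φ₁ F₁).Cor411ii (PreFrobenioidData.ofFunctor Φ₂ F₂) Ψ :=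
  cor411ii_of_exists_base_equivalence' F₁ F₂ Ψ S.isFrobenioid₁ S.isFrobenioid₂
    (exists_base_equivalence_inst_of_setting S hsq₁ hsq₂ hB₁ hB₂ hD₁ hD₂ hnd₁ hnd₂ hds₁ hds₂ hprim hprim')

end FrdI.T42

end Literature.AlgebraicGeometry.Frobenioids
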